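import Summits.Ventures.PercRepro.C025ProfileStagedLine3Core

/-!
# SESSION 4 (continued) — THE `τ`-REFINED BOUND AND LEMMA 6 (A(6)) (night-3 g12; proofs/NIGHT3-G12-LINE3.md §3)
`ls_term_le_three_div`: every `Ls`-term is `≤ 3/(|F_B||T_B|)`; `card_inner_erase`: `|T_{C∖y}| = |T_C| + 1`;
`rigid_insert_le_one_add_three_mul`: `rigid (C ∪ x) ≤ 1 + |C|·3/(|F_C| τ)` when all `C ∖ y` have `|T| = τ`;
`rigid_insert_le_one_of_forall_ovf`: the propagation step with the overflow hypothesis; **`ovf_eq_zero_of_card_five`** = Lemma 6: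
a demanding coloop-free `5`-set `C` of rank `3` with `|F_C| ≥ 2` overflows nothing at `x ∈ F_C`, unless `|F_C| = 2` and `|T_C| ∈ {2, 3}`.
-/
open scoped Matroid
namespace PercRepro
open Set Finset ThmH
namespace Staged
variable {α : Type} [DecidableEq α] {M : Matroid α} [M.Finite]

/-- The propagation step with the overflow hypothesis: if every demanding `C ∖ y` overflows nothing at `x`, `rigid (C ∪ x) ≤ 1`. -/
theorem rigid_insert_le_one_of_forall_ovf {C : Finset α} {x : α} (hCg : C ⊆ gr M) (hC3 : rkN M C = 3)
    (hfree : ∀ z ∈ C, rkN M (C.erase z) = 3) (hx : x ∈ outer M C)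
    (h : ∀ y ∈ C, 4 ≤ crk M (C.erase y) → ovf M (C.erase y) x = 0) :
    rigid M (insert x C) ≤ 1 := by
  have hxC : x ∉ C := notMem_of_mem_outer hCg hx
  have hSg : insert x C ⊆ gr M := Finset.insert_subset (mem_outer.mp hx).1 hCg
  have hk := coloops_insert_eq_singleton hCg hC3 hfree hx
  have hd : ((dcol M (insert x C)).card : ℚ) ≤ 1 := by
    have h1 : (dcol M (insert x C)).card ≤ 1 := by
      have := Finset.card_le_card (dcol_subset_coloops (M := M) (insert x C))
      rw [hk, Finset.card_singleton] at this; exact this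
    exact_mod_cast h1
  refine (rigid_le_card_dcol_of_forall_ovf_eq_zero ?_).trans hd
  intro yx hyx
  have hp := lsPairs_subset_of_coloops_eq_singleton hSg hk hyx
  rw [Finset.mem_product, Finset.mem_singleton, Finset.erase_insert hxC] at hp
  obtain ⟨hy, hx2⟩ := hp
  have hne : x ≠ yx.1 := fun h => hxC (h ▸ hy)
  have hxCy : x ∉ C.erase yx.1 := fun h => hxC (Finset.mem_of_mem_erase h)
  have hE : ((insert x C).erase yx.1).erase yx.2 = C.erase yx.1 := by
    rw [hx2, Finset.erase_insert_of_ne hne, Finset.erase_insert hxCy]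
  have hdem : 4 ≤ crk M (C.erase yx.1) := by
    have := (mem_lsPairs.mp hyx).2.2.2.1
    rw [hE] at this; exact this
  rw [hE, hx2]
  exact h yx.1 hy hdem

/-- `|T_{C ∖ y}| = |T_C| + 1` when removing `y ∈ C` keeps the rank (`C ⊆ gr M`). -/
theorem card_inner_erase {C : Finset α} {y : α} (hCg : C ⊆ gr M) (hy : y ∈ C)
    (hr : rkN M (C.erase y) = rkN M C) : (inner M (C.erase y)).card = (inner M C).card + 1 := by
  unfold inner
  rw [clF_eq_clF_of_subset_of_rkN_le (Finset.erase_subset y C) hr.ge,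
    Finset.sdiff_erase (subset_clF_self hCg hy)]
  have hy' : y ∉ clF M C \ C := by rw [Finset.mem_sdiff]; exact fun h => h.2 hy
  rw [Finset.card_insert_of_notMem hy']

/-- Every `Ls`-term of a rank-`3` demander is at most `3 / (|F_B| · |T_B|)`. -/
theorem ls_term_le_three_div {B : Finset α} (h3 : rkN M B = 3) (x : α) :
    ovf M B x / ((inner M B).card : ℚ) ≤ 3 / (((outer M B).card : ℚ) * ((inner M B).card : ℚ)) := by
  have h1 : ovf M B x ≤ 3 / ((outer M B).card : ℚ) := by
    have hovf : ovf M B x ≤ jsh M B := by unfold ovf; linarith [take_nonneg (M := M) B x]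
    have hj : (jB M B : ℚ) ≤ 3 := by exact_mod_cast jB_le_three h3
    calc ovf M B x ≤ jsh M B := hovf
      _ = (jB M B : ℚ) / ((outer M B).card : ℚ) := by simp only [jsh]
      _ ≤ 3 / ((outer M B).card : ℚ) := div_le_div_of_nonneg_right hj (by positivity)
  calc ovf M B x / ((inner M B).card : ℚ) ≤ (3 / ((outer M B).card : ℚ)) / ((inner M B).card : ℚ) :=
        div_le_div_of_nonneg_right h1 (by positivity)
    _ = 3 / (((outer M B).card : ℚ) * ((inner M B).card : ℚ)) := by rw [div_div]

/-- **The `τ`-refined (4.1)**: if every `C ∖ y` has `|T_{C∖y}| = τ`, then `rigid (C ∪ x) ≤ 1 + |C| · 3 / (|F_C| · τ)`. -/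
theorem rigid_insert_le_one_add_three_mul {C : Finset α} {x : α} {τ : ℕ} (hCg : C ⊆ gr M) (hC3 : rkN M C = 3)
    (hfree : ∀ z ∈ C, rkN M (C.erase z) = 3) (hx : x ∈ outer M C)
    (hτ : ∀ y ∈ C, (inner M (C.erase y)).card = τ) :
    rigid M (insert x C) ≤ 1 + (C.card : ℚ) * (3 / (((outer M C).card : ℚ) * (τ : ℚ))) := by
  have hxC : x ∉ C := notMem_of_mem_outer hCg hx
  have hSg : insert x C ⊆ gr M := Finset.insert_subset (mem_outer.mp hx).1 hCg
  have hk := coloops_insert_eq_singleton hCg hC3 hfree hx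
  have h0 := rigid_le_card_dcol_add (M := M) (S := insert x C)
  have hd : ((dcol M (insert x C)).card : ℚ) ≤ 1 := by
    have h1 : (dcol M (insert x C)).card ≤ 1 := by
      have := Finset.card_le_card (dcol_subset_coloops (M := M) (insert x C))
      rw [hk, Finset.card_singleton] at this; exact this
    exact_mod_cast h1
  have hterm : ∀ yx ∈ lsPairs M (insert x C), ovf M (((insert x C).erase yx.1).erase yx.2) yx.2 /
      ((inner M (((insert x C).erase yx.1).erase yx.2)).card : ℚ) ≤
      3 / (((outer M C).card : ℚ) * (τ : ℚ)) := by
    intro yx hyx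
    have hp := lsPairs_subset_of_coloops_eq_singleton hSg hk hyx
    rw [Finset.mem_product, Finset.mem_singleton, Finset.erase_insert hxC] at hp
    obtain ⟨hy, hx2⟩ := hp
    have hne : x ≠ yx.1 := fun h => hxC (h ▸ hy)
    have hxCy : x ∉ C.erase yx.1 := fun h => hxC (Finset.mem_of_mem_erase h)
    have hE : ((insert x C).erase yx.1).erase yx.2 = C.erase yx.1 := by
      rw [hx2, Finset.erase_insert_of_ne hne, Finset.erase_insert hxCy]
    rw [hE, hτ yx.1 hy]
    have h3' : rkN M (C.erase yx.1) = 3 := hfree yx.1 hy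
    have hout : outer M (C.erase yx.1) = outer M C :=
      outer_erase_eq_of_rkN_erase_eq (by rw [h3', hC3])
    have := ls_term_le_three_div (M := M) h3' yx.2
    rw [hout, hτ yx.1 hy] at this
    exact this
  have hsum : ∑ yx ∈ lsPairs M (insert x C), ovf M (((insert x C).erase yx.1).erase yx.2) yx.2 /
      ((inner M (((insert x C).erase yx.1).erase yx.2)).card : ℚ) ≤
      ((lsPairs M (insert x C)).card : ℚ) * (3 / (((outer M C).card : ℚ) * (τ : ℚ))) := by
    calc _ ≤ ∑ _yx ∈ lsPairs M (insert x C), 3 / (((outer M C).card : ℚ) * (τ : ℚ)) :=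
          Finset.sum_le_sum hterm
      _ = _ := by rw [Finset.sum_const, nsmul_eq_mul]
  have hcard : ((lsPairs M (insert x C)).card : ℚ) ≤ (C.card : ℚ) := by
    have h1 : (lsPairs M (insert x C)).card ≤ (((insert x C).erase x) ×ˢ ({x} : Finset α)).card :=
      Finset.card_le_card (lsPairs_subset_of_coloops_eq_singleton hSg hk)
    rw [Finset.card_product, Finset.card_singleton, mul_one, Finset.erase_insert hxC] at h1
    exact_mod_cast h1
  have hnn : (0 : ℚ) ≤ 3 / (((outer M C).card : ℚ) * (τ : ℚ)) := by positivity
  calc rigid M (insert x C) ≤ ((dcol M (insert x C)).card : ℚ) +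
        ∑ yx ∈ lsPairs M (insert x C), ovf M (((insert x C).erase yx.1).erase yx.2) yx.2 /
          ((inner M (((insert x C).erase yx.1).erase yx.2)).card : ℚ) := h0
    _ ≤ 1 + (C.card : ℚ) * (3 / (((outer M C).card : ℚ) * (τ : ℚ))) :=
        add_le_add hd (hsum.trans (mul_le_mul_of_nonneg_right hcard hnn))

/-- **Lemma 6 of LINE3 (A(6))**: a demanding coloop-free `5`-set `C ⊆ gr M` of rank `3` with `|F_C| ≥ 2` overflows nothing at
`x ∈ F_C` — except possibly when `|F_C| = 2` and `|T_C| ∈ {2, 3}` (the two small cases, Lemma 8). -/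
theorem ovf_eq_zero_of_card_five {C : Finset α} {x : α} (hCg : C ⊆ gr M) (hC3 : rkN M C = 3)
    (hfree : ∀ z ∈ C, rkN M (C.erase z) = 3) (hc : C.card = 5) (hd : 4 ≤ crk M C) (hx : x ∈ outer M C)
    (hF : 2 ≤ (outer M C).card)
    (hex : ¬ ((outer M C).card = 2 ∧ ((inner M C).card = 2 ∨ (inner M C).card = 3))) :
    ovf M C x = 0 := by
  rcases Finset.eq_empty_or_nonempty (inner M C) with hE | hne
  · exact ovf_eq_zero_of_inner_empty hCg hE x
  have hi1 : 1 ≤ (inner M C).card := Finset.card_pos.mpr hne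
  apply ovf_eq_zero_of_rigid_le
  · rw [dcol_insert_eq_singleton hCg hC3 hfree hd hx, Finset.card_singleton]
  have hf2 : (2 : ℚ) ≤ ((outer M C).card : ℚ) := by exact_mod_cast hF
  have hfpos : (0 : ℚ) < ((outer M C).card : ℚ) := by linarith
  have hr1 : rigid M (insert x C) ≤ 1 + 5 / ((outer M C).card : ℚ) := by
    have := rigid_insert_le_one_add hCg hC3 hfree hx
    rw [hc] at this; push_cast at this; exact this
  have hτ : ∀ y ∈ C, (inner M (C.erase y)).card = (inner M C).card + 1 :=
    fun y hy => card_inner_erase hCg hy (by rw [hfree y hy, hC3])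
  have hr2 : rigid M (insert x C) ≤
      1 + 5 * (3 / (((outer M C).card : ℚ) * (((inner M C).card : ℚ) + 1))) := by
    have := rigid_insert_le_one_add_three_mul hCg hC3 hfree hx hτ
    rw [hc] at this; push_cast at this; exact this
  have hj1 : jsh M C ≤ ((inner M C).card : ℚ) / ((outer M C).card : ℚ) := by
    unfold jsh
    apply div_le_div_of_nonneg_right _ hfpos.le
    exact_mod_cast jB_le_card_inner hCg
  have hj2 : jsh M C ≤ 3 / ((outer M C).card : ℚ) := by
    unfold jsh
    apply div_le_div_of_nonneg_right _ hfpos.le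
    exact_mod_cast jB_le_three hC3
  have key : rigid M (insert x C) + jsh M C ≤ 4 := by
    rcases Nat.lt_or_ge (inner M C).card 4 with hlt | hge
    · interval_cases h : (inner M C).card
      · -- |T| = 1
        have h6 : 6 / ((outer M C).card : ℚ) ≤ 3 := by rw [div_le_iff₀ hfpos]; linarith
        have e : 5 / ((outer M C).card : ℚ) + 1 / ((outer M C).card : ℚ) = 6 / ((outer M C).card : ℚ) := by
          ring
        push_cast at hj1
        linarith
      · -- |T| = 2: then |F| ≥ 3
        have hf3 : (3 : ℚ) ≤ ((outer M C).card : ℚ) := by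
          have : (outer M C).card ≠ 2 := fun h2 => hex ⟨h2, Or.inl rfl⟩
          have : 3 ≤ (outer M C).card := by omega
          exact_mod_cast this
        have h7 : 7 / ((outer M C).card : ℚ) ≤ 3 := by rw [div_le_iff₀ hfpos]; linarith
        have e : 5 / ((outer M C).card : ℚ) + 2 / ((outer M C).card : ℚ) = 7 / ((outer M C).card : ℚ) := by
          ring
        push_cast at hj1
        linarith
      · -- |T| = 3: then |F| ≥ 3
        have hf3 : (3 : ℚ) ≤ ((outer M C).card : ℚ) := by
          have : (outer M C).card ≠ 2 := fun h2 => hex ⟨h2, Or.inr rfl⟩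
          have : 3 ≤ (outer M C).card := by omega
          exact_mod_cast this
        have h27 : 5 * (3 / (((outer M C).card : ℚ) * ((3 : ℚ) + 1))) + 3 / ((outer M C).card : ℚ) ≤ 3 := by
          have e : 5 * (3 / (((outer M C).card : ℚ) * ((3 : ℚ) + 1))) + 3 / ((outer M C).card : ℚ)
              = 27 / (4 * ((outer M C).card : ℚ)) := by
            field_simp
            ring
          rw [e, div_le_iff₀ (by positivity)]
          linarith
        push_cast at hr2
        linarith
    · -- |T| ≥ 4
      have hi4 : (4 : ℚ) ≤ ((inner M C).card : ℚ) := by exact_mod_cast hge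
      have h15 : 5 * (3 / (((outer M C).card : ℚ) * (((inner M C).card : ℚ) + 1))) ≤
          3 / ((outer M C).card : ℚ) := by
        rw [show 5 * (3 / (((outer M C).card : ℚ) * (((inner M C).card : ℚ) + 1)))
            = 15 / (((outer M C).card : ℚ) * (((inner M C).card : ℚ) + 1)) by ring]
        rw [div_le_div_iff₀ (by positivity) hfpos]
        nlinarith [mul_nonneg hfpos.le (sub_nonneg.mpr hi4)]
      have h6 : 6 / ((outer M C).card : ℚ) ≤ 3 := by rw [div_le_iff₀ hfpos]; linarith
      have e : 3 / ((outer M C).card : ℚ) + 3 / ((outer M C).card : ℚ) = 6 / ((outer M C).card : ℚ) := by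
        ring
      linarith
  linarith

end Staged
end PercRepro

/-!
# SESSION 4 (continued) — LEMMA 7 (PROPAGATION BY INDUCTION ON `|C|`) (night-3 g12; proofs/NIGHT3-G12-LINE3.md §3)
In a matroid whose rank-`≤ 2` subsets of the ground set have `≤ 3` points (`h3line` — "all lines have at most `3` points"), if every
demanding coloop-free `5`-subset `C'` of the plane `P` overflows nothing at `x` (the hypothesis `H5`, supplied by Lemma 6 off the two small
cases), then every coloop-free rank-`3` set `C ⊆ P` with `|C| ≥ 6`, `cl C = P`, `x ∈ F_C`, `|F_C| ≥ 2` has `rigid (C ∪ x) ≤ 1`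
(`rigid_insert_le_one_of_six_le_card`). The predecessors `C ∖ y` are coloop-free because four collinear points do not exist.
-/
open scoped Matroid
namespace PercRepro
open Set Finset ThmH
namespace Staged
variable {α : Type} [DecidableEq α] {M : Matroid α} [M.Finite]

/-- **Lemma 7 of LINE3**: propagation of the absorption from the `5`-sets upward, by strong induction on `|C|`. -/
theorem rigid_insert_le_one_of_six_le_card (h3line : ∀ X ⊆ gr M, rkN M X ≤ 2 → X.card ≤ 3) {P : Finset α} {x : α}
    (H5 : ∀ C' ⊆ gr M, clF M C' = P → rkN M C' = 3 → (∀ z ∈ C', rkN M (C'.erase z) = 3) → C'.card = 5 →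
      4 ≤ crk M C' → ovf M C' x = 0) :
    ∀ n : ℕ, ∀ C ⊆ gr M, C.card = n → 6 ≤ n → clF M C = P → rkN M C = 3 → (∀ z ∈ C, rkN M (C.erase z) = 3) →
      x ∈ outer M C → 2 ≤ (outer M C).card → rigid M (insert x C) ≤ 1 := by
  intro n
  induction n using Nat.strong_induction_on with
  | _ n ih =>
  intro C hCg hcard h6 hP hC3 hfree hx hF
  apply rigid_insert_le_one_of_forall_ovf hCg hC3 hfree hx
  intro y hy hdem
  have hC'g : C.erase y ⊆ gr M := (Finset.erase_subset _ _).trans hCg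
  have hC'3 : rkN M (C.erase y) = 3 := hfree y hy
  have hcl' : clF M (C.erase y) = P := by
    rw [← hP]; exact clF_eq_clF_of_subset_of_rkN_le (Finset.erase_subset y C) (by rw [hC'3, hC3])
  have hcard' : (C.erase y).card = n - 1 := by rw [Finset.card_erase_of_mem hy, hcard]
  have hfree' : ∀ z ∈ C.erase y, rkN M ((C.erase y).erase z) = 3 := by
    intro z hz
    have hle : rkN M ((C.erase y).erase z) ≤ 3 := by
      rw [← hC'3]; exact rkN_mono (Finset.erase_subset _ _)
    have hcard2 : ((C.erase y).erase z).card = n - 2 := by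
      rw [Finset.card_erase_of_mem hz, hcard']; omega
    by_contra hne
    have h2 : rkN M ((C.erase y).erase z) ≤ 2 := by omega
    have := h3line _ ((Finset.erase_subset _ _).trans hC'g) h2
    omega
  have hout : outer M (C.erase y) = outer M C := outer_erase_eq_of_rkN_erase_eq (by rw [hC'3, hC3])
  have hx' : x ∈ outer M (C.erase y) := by rw [hout]; exact hx
  have hF' : 2 ≤ (outer M (C.erase y)).card := by rw [hout]; exact hF
  rcases Nat.lt_or_ge (n - 1) 6 with hlt | hge
  · have h5 : (C.erase y).card = 5 := by omega
    exact H5 _ hC'g hcl' hC'3 hfree' h5 hdem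
  · have hr := ih (n - 1) (by omega) (C.erase y) hC'g hcard' hge hcl' hC'3 hfree' hx' hF'
    apply ovf_eq_zero_of_rigid_le
    · rw [dcol_insert_eq_singleton hC'g hC'3 hfree' hdem hx', Finset.card_singleton]
    · have hf2 : (2 : ℚ) ≤ ((outer M (C.erase y)).card : ℚ) := by exact_mod_cast hF'
      have hfpos : (0 : ℚ) < ((outer M (C.erase y)).card : ℚ) := by linarith
      have hj : jsh M (C.erase y) ≤ 3 / 2 := by
        have h1 : jsh M (C.erase y) ≤ 3 / ((outer M (C.erase y)).card : ℚ) := by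
          unfold jsh
          apply div_le_div_of_nonneg_right _ hfpos.le
          exact_mod_cast jB_le_three hC'3
        have h2 : 3 / ((outer M (C.erase y)).card : ℚ) ≤ 3 / 2 := by
          rw [div_le_iff₀ hfpos]; linarith
        linarith
      linarith

end Staged
end PercRepro

/-!
# SESSION 4 (continued) — THE ONE-COLOOP CASE OF THEOREM L3 OFF THE TWO SMALL CASES (night-3 g12; proofs/NIGHT3-G12-LINE3.md §4)
`rigid_insert_le_four_line3`: in a matroid of rank `≥ 5` whose rank-`≤ 2` sets have `≤ 3` points, every `C ∪ {x}` with `C ⊆ gr M`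
coloop-free of rank `3` and `x ∈ F_C` has `rigid ≤ 4` — unless `|F_C| = 2` and the plane `cl C` has `7` or `8` points (Lemma 8's
cases, M = M|P ⊕ U_{2,2}). Lemma 4 for `|C| ≤ 3|F_C|`; otherwise `|C| ≥ 6` and Lemmas 6 + 7 give `rigid ≤ 1`.
-/
open scoped Matroid
namespace PercRepro
open Set Finset ThmH
namespace Staged
variable {α : Type} [DecidableEq α] {M : Matroid α} [M.Finite]

/-- `|T_C| = |cl C| − |C|` for `C ⊆ gr M`. -/
theorem card_inner_add_card {C : Finset α} (hCg : C ⊆ gr M) : (inner M C).card + C.card = (clF M C).card := by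
  unfold inner
  exact Finset.card_sdiff_add_card_eq_card (subset_clF_self hCg)

/-- **The one-coloop case of Theorem L3, off the two small cases**: rank `≥ 5`, all lines `≤ 3` points, `C ⊆ gr M` coloop-free of
rank `3`, `x ∈ F_C`, and not (`|F_C| = 2` and `|cl C| ∈ {7, 8}`) give `rigid (C ∪ x) ≤ 4`. -/
theorem rigid_insert_le_four_line3 (h3line : ∀ X ⊆ gr M, rkN M X ≤ 2 → X.card ≤ 3) (hR : (5 : ℕ∞) ≤ M.eRank)
    {C : Finset α} {x : α} (hCg : C ⊆ gr M) (hC3 : rkN M C = 3) (hfree : ∀ z ∈ C, rkN M (C.erase z) = 3)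
    (hx : x ∈ outer M C)
    (hex : ¬ ((outer M C).card = 2 ∧ ((clF M C).card = 7 ∨ (clF M C).card = 8))) :
    rigid M (insert x C) ≤ 4 := by
  have hF : 2 ≤ (outer M C).card := two_le_card_outer hC3 hR
  by_cases hle : C.card ≤ 3 * (outer M C).card
  · exact rigid_insert_le_four_of_card_le hCg hC3 hfree hx hle
  have h6 : 6 ≤ C.card := by omega
  have H5 : ∀ C' ⊆ gr M, clF M C' = clF M C → rkN M C' = 3 → (∀ z ∈ C', rkN M (C'.erase z) = 3) →
      C'.card = 5 → 4 ≤ crk M C' → ovf M C' x = 0 := by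
    intro C' hC'g hcl hC'3 hfree' hc5 hdem
    have hout : outer M C' = outer M C := by unfold outer; rw [hcl]
    have hx' : x ∈ outer M C' := by rw [hout]; exact hx
    have hF' : 2 ≤ (outer M C').card := by rw [hout]; exact hF
    apply ovf_eq_zero_of_card_five hC'g hC'3 hfree' hc5 hdem hx' hF'
    rw [hout]
    have hin := card_inner_add_card (M := M) hC'g
    rw [hcl, hc5] at hin
    intro h
    apply hex
    refine ⟨h.1, ?_⟩
    rcases h.2 with h2 | h3
    · left; omega
    · right; omega
  have h1 := rigid_insert_le_one_of_six_le_card h3line H5 C.card C hCg rfl h6 rfl hC3 hfree hx hF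
  linarith

end Staged
end PercRepro
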